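import Summits.QuantumAdvantage.AdviceFreeQNC0.TensorBlocks
import Summits.QuantumAdvantage.AdviceFreeQNC0.SumCodeDegreeZero
import Mathlib.LinearAlgebra.Finsupp.LinearCombination
import HarnessLib

/-!
# Cell qa-qnc0 (rung F-Q1, crux α `RingToElim` / density target T10, many-blocks corner):
# BLOCK SPLITTING for a general monotone block map (the engine of `BlockSplit` / `BlockSplitFixed`)

Planner qa-qnc0-p1 gen 13 (`HOME/qa-qnc0-p1/ROUND-12.md` §2.1, `Sketch13.lean`, ask P18; PROVER NOTE
of ROUND-12 §2.7(c): "prove `BlockSplit` in the form ANY k disjoint blocks with `D < (t+1)(k−1)`,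
remainder free").  Walk game in walk coordinates (`ringWinU`, charge `c`) on `N` bits, a walk
strategy `y` with all selectors of `𝔽₂`-degree `≤ D`, and a block map `blk : Fin N → ℕ` that is
MONOTONE (so every block `blk⁻¹(j)` is an interval and the blocks sit in order); blocks `j < k` are
the TERM-CARRYING blocks, coordinates with `blk i ≥ k` are a free remainder.

* `sumCodeWinB_ringWinU` (**block splitting**): if `0 < k` and `D < (t+1)(k−1)` then the WIN pattern
  `ringWinU c y` lies in the `k`-block SUM CODE at block degree `t` for the block map `blk`
  (`SumCodeWinB`, = Sketch13's `SumCodeWin` with `blockIdx n k` replaced by `blk` — definitionally,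
  see `TensorBlocksFixed.lean`).  Proof (ROUND-12 §2.1): expand every selector into monomials
  `u^S`, `|S| ≤ D` (`lowDeg = span of monomials`); a cut `g` is interior to at most ONE block
  (monotonicity), so among the other `≥ k − 1` blocks pigeonhole finds `j` with `|S ∩ B_j| ≤ t`
  (`exists_block`); on block `j`'s fibres the character of `g` is `e_g(u ⊕_j 0) + ε·|u_j|`,
  `ε ∈ {1,2}` (`walkExp_split`: the block lies entirely left or entirely right of the cut), so the
  term `u^S·[e_g ≢ 0]` is the `|u_j| mod 3`-th member of the EVEN triple
  `r ↦ u^S·[e_g(u ⊕_j 0) + ε r ≢ 0]` of block-degree `|S ∩ B_j| ≤ t`; summing the terms assigned to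
  `j` in `𝔽₂` gives `X_j` and its triple `T_j`.

WHAT THIS IS NOT: no multiplicativity (`TensorMult t β`, `t ≥ 1`, is the OPEN crux MULT₁); nothing on
α / T10W; separation NOT moved.  The instances `BlockSplit` (blocks `⌊ik/n⌋`) and `BlockSplitFixed`
(`k` leading intervals of one size, free remainder) are one-liners from this file.
-/

noncomputable section

namespace Summit.QuantumAdvantage.AdviceFreeQNC0

open Finset
open Literature.Computability.MetaComplexity Literature.Computability.MetaComplexity.Smolensky

namespace BlockSplitCore

variable {N : ℕ} (blk : Fin N → ℕ)

/-! ### The sum code for a general block map (Sketch13's words with `blockIdx n k ↦ blk`) -/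

/-- `T` has `𝔽₂`-degree `≤ t` in the block-`j` bits, all other bits fixed arbitrarily. -/
def HasBlockDegB (j t : ℕ) (T : (Fin N → Bool) → Bool) : Prop :=
  ∀ v : Fin N → Bool, HasDeg (fun w => T (SumCodeZero.ovr blk j v w)) t

/-- On every block-`j` fibre `X` is the win pattern of an EVEN triple of block-degree `≤ t`. -/
def IsBlockElimB (j t : ℕ) (X : (Fin N → Bool) → Bool) : Prop :=
  ∃ T : ℕ → (Fin N → Bool) → Bool,
    (∀ r, HasBlockDegB blk j t (T r)) ∧
    (∀ u, xor (T 0 u) (xor (T 1 u) (T 2 u)) = false) ∧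
    ∀ u, X u = T (SumCodeZero.bw blk j u % 3) u

/-- `win = ⊕_{j<k} X_j` with every `X_j` a block-`j` pattern: the `k`-block SUM CODE at block degree `t`. -/
def SumCodeWinB (k t : ℕ) (win : (Fin N → Bool) → Bool) : Prop :=
  ∃ X : ℕ → (Fin N → Bool) → Bool, (∀ j < k, IsBlockElimB blk j t (X j)) ∧
    ∀ u, win u = decide (((range k).filter fun j => X j u = true).card % 2 = 1)

variable {blk}

/-! ### The walk exponent split along a one-sided block -/

/-- The all-zero input. -/
def zer : Fin N → Bool := fun _ => false

/-- Coefficient of coordinate `i` in the walk exponent at the cut `g`: `2` left of the cut, `1` right. -/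
def kap (g : ℕ) (i : Fin N) : ℕ := if i.val < g then 2 else 1

/-- `e_g(U) − c − g = |U| + W_g(U) = Σ_i κ_g(i)·U_i`. -/
theorem walkExp_eq_sum (U : Fin N → Bool) (g : ℕ) :
    walkExp U g = ∑ i : Fin N, if U i = true then kap g i else 0 := by
  unfold walkExp wt wtPrefix kap
  rw [Finset.card_filter, Finset.card_filter, ← Finset.sum_add_distrib]
  refine Finset.sum_congr rfl fun i _ => ?_
  by_cases hU : U i = true <;> by_cases hi : i.val < g <;> simp [hU, hi]

/-- Block `j` lies entirely LEFT of the cut `g` or entirely RIGHT of it (at it). -/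
def OneSided (blk : Fin N → ℕ) (j g : ℕ) : Prop :=
  (∀ i : Fin N, blk i = j → i.val < g) ∨ (∀ i : Fin N, blk i = j → g ≤ i.val)

/-- The common coefficient `ε ∈ {1,2}` of the block-`j` bits at a one-sided cut. -/
def eps (blk : Fin N → ℕ) (j g : ℕ) : ℕ := by
  classical exact if (∀ i : Fin N, blk i = j → i.val < g) then 2 else 1

/-- `ε ∈ {1, 2}`. -/
theorem eps_eq (j g : ℕ) : eps blk j g = 1 ∨ eps blk j g = 2 := by
  unfold eps; split_ifs; exacts [Or.inr rfl, Or.inl rfl]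

/-- At a one-sided cut every block-`j` coordinate has coefficient `ε`. -/
theorem kap_eq_eps {j g : ℕ} (h : OneSided blk j g) (i : Fin N) (hi : blk i = j) :
    kap g i = eps blk j g := by
  unfold kap eps
  by_cases hl : ∀ i : Fin N, blk i = j → i.val < g
  · rw [if_pos (hl i hi), if_pos hl]
  · rw [if_neg hl]
    rcases h with h | h
    · exact absurd h hl
    · rw [if_neg (Nat.not_lt.2 (h i hi))]

/-- Overriding block `j` twice keeps the last override. -/
theorem ovr_ovr (j : ℕ) (u a b : Fin N → Bool) :
    SumCodeZero.ovr blk j (SumCodeZero.ovr blk j u a) b = SumCodeZero.ovr blk j u b := by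
  funext i
  unfold SumCodeZero.ovr
  by_cases h : blk i = j <;> simp [h]

/-- **The split**: at a one-sided cut, `e_g(U) = e_g(U ⊕_j 0) + ε·|U_j|`. -/
theorem walkExp_split {j g : ℕ} (h : OneSided blk j g) (U : Fin N → Bool) :
    walkExp U g = walkExp (SumCodeZero.ovr blk j U zer) g + eps blk j g * SumCodeZero.bw blk j U := by
  rw [walkExp_eq_sum, walkExp_eq_sum,
    ← Finset.sum_filter_add_sum_filter_not univ (fun i : Fin N => blk i = j),
    ← Finset.sum_filter_add_sum_filter_not univ (fun i : Fin N => blk i = j)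
      (fun i => if SumCodeZero.ovr blk j U zer i = true then kap g i else 0)]
  have h1 : ∑ i ∈ univ.filter (fun i : Fin N => blk i = j), (if U i = true then kap g i else 0) =
      eps blk j g * SumCodeZero.bw blk j U := by
    rw [Finset.sum_congr rfl fun i hi => by rw [kap_eq_eps h i (mem_filter.1 hi).2],
      ← Finset.sum_filter, Finset.sum_const, smul_eq_mul, mul_comm, filter_filter]
    rfl
  have h2 : ∑ i ∈ univ.filter (fun i : Fin N => blk i = j),
      (if SumCodeZero.ovr blk j U zer i = true then kap g i else 0) = 0 := by
    refine Finset.sum_eq_zero fun i hi => ?_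
    have : SumCodeZero.ovr blk j U zer i = false := by
      unfold SumCodeZero.ovr zer; rw [if_pos (mem_filter.1 hi).2]
    rw [this]; simp
  have h3 : ∑ i ∈ univ.filter (fun i : Fin N => ¬ blk i = j),
      (if SumCodeZero.ovr blk j U zer i = true then kap g i else 0) =
      ∑ i ∈ univ.filter (fun i : Fin N => ¬ blk i = j), (if U i = true then kap g i else 0) := by
    refine Finset.sum_congr rfl fun i hi => ?_
    have : SumCodeZero.ovr blk j U zer i = U i := by
      unfold SumCodeZero.ovr; rw [if_neg (mem_filter.1 hi).2]
    rw [this]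
  rw [h1, h2, h3]
  ring

/-- The character of the cut `g` read on block `j`'s residue `r`: `c + g + e_g(U ⊕_j 0) + ε r`. -/
def chR (blk : Fin N → ℕ) (c g j r : ℕ) (U : Fin N → Bool) : ℕ :=
  c + g + walkExp (SumCodeZero.ovr blk j U zer) g + eps blk j g * r

/-- At a one-sided cut the character is its block-`j` reading at `r = |U_j| mod 3`. -/
theorem char_mod_eq {j g : ℕ} (h : OneSided blk j g) (c : ℕ) (U : Fin N → Bool) :
    (c + g + walkExp U g) % 3 = chR blk c g j (SumCodeZero.bw blk j U % 3) U % 3 := by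
  rw [walkExp_split h]
  unfold chR
  rcases eps_eq (blk := blk) j g with h1 | h2
  · rw [h1]; omega
  · rw [h2]; omega

/-- The reading only depends on the off-block bits. -/
theorem chR_ovr (c g j r : ℕ) (U a : Fin N → Bool) :
    chR blk c g j r (SumCodeZero.ovr blk j U a) = chR blk c g j r U := by
  unfold chR; rw [ovr_ovr]

/-- Residue bookkeeping: `A`, `A + ε`, `A + 2ε` (`ε ∈ {1,2}`) hit `0 mod 3` exactly once. -/
private theorem xor3_residues (A e : ℕ) (he : e = 1 ∨ e = 2) :
    xor (decide ((A + e * 0) % 3 ≠ 0)) (xor (decide ((A + e * 1) % 3 ≠ 0))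
      (decide ((A + e * 2) % 3 ≠ 0))) = false := by
  have hA : A % 3 = 0 ∨ A % 3 = 1 ∨ A % 3 = 2 := by omega
  rcases he with rfl | rfl <;> rcases hA with hA | hA | hA <;>
    simp [Nat.add_mod, hA]

/-- The three readings form an EVEN triple. -/
theorem chR_even (c g j : ℕ) (U : Fin N → Bool) :
    xor (decide (chR blk c g j 0 U % 3 ≠ 0)) (xor (decide (chR blk c g j 1 U % 3 ≠ 0))
      (decide (chR blk c g j 2 U % 3 ≠ 0))) = false :=
  xor3_residues _ _ (eps_eq j g)

/-! ### Pigeonhole: a block on one side of the cut meeting the monomial in `≤ t` coordinates -/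

/-- For a MONOTONE block map at most one block straddles a cut. -/
theorem straddle_unique (hmono : ∀ i i' : Fin N, i ≤ i' → blk i ≤ blk i') {g j j' : ℕ}
    (hj : ¬ OneSided blk j g) (hj' : ¬ OneSided blk j' g) : j = j' := by
  unfold OneSided at hj hj'
  simp only [not_or, not_forall, not_lt, not_le, exists_prop] at hj hj'
  obtain ⟨⟨i₁, hi₁, hg₁⟩, ⟨i₂, hi₂, hg₂⟩⟩ := hj
  obtain ⟨⟨i₁', hi₁', hg₁'⟩, ⟨i₂', hi₂', hg₂'⟩⟩ := hj'
  have h1 : blk i₂ ≤ blk i₁' := hmono i₂ i₁' (by change i₂.val ≤ i₁'.val; omega)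
  have h2 : blk i₂' ≤ blk i₁ := hmono i₂' i₁ (by change i₂'.val ≤ i₁.val; omega)
  rw [hi₂, hi₁'] at h1
  rw [hi₂', hi₁] at h2
  omega

/-- **Pigeonhole.**  `0 < k`, `D < (t+1)(k−1)`, `|S| ≤ D`: some block `j < k` lies on one side of the
cut `g` and meets `S` in at most `t` coordinates. -/
theorem exists_block (hmono : ∀ i i' : Fin N, i ≤ i' → blk i ≤ blk i') {k t D : ℕ} (hk : 0 < k)
    (hD : D < (t + 1) * (k - 1)) (g : ℕ) (S : Finset (Fin N)) (hS : S.card ≤ D) :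
    ∃ j, j < k ∧ OneSided blk j g ∧ (S.filter fun i => blk i = j).card ≤ t := by
  classical
  set J := (range k).filter fun j => OneSided blk j g with hJ
  -- all but at most one block are one-sided
  have hJc : k - 1 ≤ J.card := by
    have hsum : J.card + ((range k).filter fun j => ¬ OneSided blk j g).card = k := by
      rw [hJ]
      have := Finset.card_filter_add_card_filter_not
        (s := range k) (fun j => OneSided blk j g)
      rwa [card_range] at this
    have hle : ((range k).filter fun j => ¬ OneSided blk j g).card ≤ 1 :=
      Finset.card_le_one.2 fun a ha b hb =>
        straddle_unique hmono (mem_filter.1 ha).2 (mem_filter.1 hb).2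
    omega
  by_contra hcon
  have hall : ∀ j ∈ J, t + 1 ≤ (S.filter fun i => blk i = j).card := by
    intro j hj
    by_contra h'
    exact hcon ⟨j, mem_range.1 (mem_filter.1 hj).1, (mem_filter.1 hj).2, by omega⟩
  have hsum : J.card * (t + 1) ≤ ∑ j ∈ J, (S.filter fun i => blk i = j).card := by
    have := Finset.card_nsmul_le_sum J (fun j => (S.filter fun i => blk i = j).card) (t + 1) hall
    simpa using this
  have hfib : ∑ j ∈ J, (S.filter fun i => blk i = j).card = (S.filter fun i => blk i ∈ J).card := by
    rw [Finset.card_eq_sum_card_fiberwise (f := blk) (t := J) (s := S.filter fun i => blk i ∈ J)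
      (fun i hi => (mem_filter.1 hi).2)]
    refine Finset.sum_congr rfl fun j hj => ?_
    congr 1
    ext i
    simp only [mem_filter]
    constructor
    · rintro ⟨hi, h⟩; exact ⟨⟨hi, h ▸ hj⟩, h⟩
    · rintro ⟨⟨hi, _⟩, h⟩; exact ⟨hi, h⟩
  have hle : (S.filter fun i => blk i ∈ J).card ≤ D := (card_filter_le _ _).trans hS
  have hk1 : (k - 1) * (t + 1) ≤ J.card * (t + 1) := Nat.mul_le_mul_right _ hJc
  have : (t + 1) * (k - 1) = (k - 1) * (t + 1) := Nat.mul_comm _ _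
  omega

/-! ### Monomials on block fibres -/

/-- `u^S` at an override of block `j` factors through the block: `x_S(v ⊕_j w) = x_{S∖B_j}(v)·x_{S∩B_j}(w)`. -/
theorem mono_ovr (j : ℕ) (S : Finset (Fin N)) (v w : Fin N → Bool) :
    mono (ZMod 2) S (SumCodeZero.ovr blk j v w) =
      mono (ZMod 2) (S.filter fun i => ¬ blk i = j) v * mono (ZMod 2) (S.filter fun i => blk i = j) w := by
  unfold mono
  rw [← Finset.prod_filter_mul_prod_filter_not S (fun i => blk i = j), mul_comm]
  congr 1
  · refine Finset.prod_congr rfl fun i hi => ?_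
    have : SumCodeZero.ovr blk j v w i = v i := by
      unfold SumCodeZero.ovr; rw [if_neg (mem_filter.1 hi).2]
    rw [this]
  · refine Finset.prod_congr rfl fun i hi => ?_
    have : SumCodeZero.ovr blk j v w i = w i := by
      unfold SumCodeZero.ovr; rw [if_pos (mem_filter.1 hi).2]
    rw [this]

/-! ### `𝔽₂` bookkeeping -/

/-- The `𝔽₂`-indicator of a bit. -/
def ind (b : Bool) : ZMod 2 := if b = true then 1 else 0

/-- `[x = 1] = x` in `𝔽₂`. -/
theorem ind_decide_eq_one (x : ZMod 2) : ind (decide (x = 1)) = x := by fin_cases x <;> rfl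

/-- `[m odd] = m` in `𝔽₂`. -/
theorem ind_decide_mod_two (m : ℕ) : ind (decide (m % 2 = 1)) = (m : ZMod 2) := by
  rw [← ZMod.natCast_mod m 2]
  rcases Nat.mod_two_eq_zero_or_one m with h | h <;> simp [ind, h]

/-- `x + y + z = 0` in `𝔽₂` makes `([x=1],[y=1],[z=1])` an even triple. -/
theorem xor3_of_sum_zero (x y z : ZMod 2) (h : x + y + z = 0) :
    xor (decide (x = 1)) (xor (decide (y = 1)) (decide (z = 1))) = false := by
  revert h; fin_cases x <;> fin_cases y <;> fin_cases z <;> decide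

/-- An even triple of bits sums to `0` in `𝔽₂`. -/
theorem ind_add3_of_xor (b0 b1 b2 : Bool) (h : xor b0 (xor b1 b2) = false) :
    ind b0 + ind b1 + ind b2 = 0 := by
  revert h; cases b0 <;> cases b1 <;> cases b2 <;> decide

/-- `#{x ∈ s : P x}` in `𝔽₂` is the sum of the indicators. -/
theorem card_filter_cast (ι : Type*) (s : Finset ι) (P : ι → Prop) [DecidablePred P] :
    (((s.filter P).card : ℕ) : ZMod 2) = ∑ x ∈ s, if P x then (1 : ZMod 2) else 0 := by
  rw [Finset.card_filter]
  push_cast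
  rfl

/-- Monomial expansion of a low-degree Boolean function. -/
theorem exists_coeffs {D : ℕ} {f : (Fin N → Bool) → Bool} (hf : HasDeg f D) :
    ∃ a : {S : Finset (Fin N) // S.card ≤ D} → ZMod 2,
      ∀ U, ind (f U) = ∑ S, a S * mono (ZMod 2) S.1 U := by
  unfold HasDeg at hf
  rw [lowDeg_eq_span, Submodule.mem_span_range_iff_exists_fun] at hf
  obtain ⟨a, ha⟩ := hf
  refine ⟨a, fun U => ?_⟩
  have := congrFun ha U
  simp only [Finset.sum_apply, Pi.smul_apply, smul_eq_mul] at this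
  unfold ind
  exact this.symm

/-! ### Block splitting -/

/-- **BLOCK SPLITTING** (ROUND-12 §2.1) for a monotone block map: with `0 < k` term-carrying blocks and
`D < (t+1)(k−1)`, the WIN pattern of every degree-`D` walk strategy (every charge) lies in the `k`-block
sum code at block degree `t`. -/
theorem sumCodeWinB_ringWinU (hmono : ∀ i i' : Fin N, i ≤ i' → blk i ≤ blk i')
    {k t D : ℕ} (hk : 0 < k) (hD : D < (t + 1) * (k - 1)) (c : ℕ)
    (y : Fin (N + 1) → (Fin N → Bool) → Bool) (hdeg : ∀ g, HasDeg (y g) D) :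
    SumCodeWinB blk k t (ringWinU c y) := by
  classical
  -- monomial expansions of the selectors and the block assignment of the terms
  choose a ha using fun g => exists_coeffs (hdeg g)
  choose asg hasg using fun (g : Fin (N + 1)) (S : {S : Finset (Fin N) // S.card ≤ D}) =>
    exists_block hmono hk hD g.val S.1 S.2
  -- the terms, the block sums `F j`, the triples `G j r`
  set term : Fin (N + 1) × {S : Finset (Fin N) // S.card ≤ D} → (Fin N → Bool) → ZMod 2 :=
    fun p U => a p.1 p.2 * mono (ZMod 2) p.2.1 U *
      ind (decide ((c + p.1.val + walkExp U p.1.val) % 3 ≠ 0)) with hterm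
  set fib : ℕ → Finset (Fin (N + 1) × {S : Finset (Fin N) // S.card ≤ D}) :=
    fun j => univ.filter fun p => asg p.1 p.2 = j with hfib
  set G : ℕ → ℕ → (Fin N → Bool) → ZMod 2 := fun j r U =>
    ∑ p ∈ fib j, a p.1 p.2 * mono (ZMod 2) p.2.1 U * ind (decide (chR blk c p.1.val j r U % 3 ≠ 0))
    with hG
  set F : ℕ → (Fin N → Bool) → ZMod 2 := fun j U => ∑ p ∈ fib j, term p U with hF
  -- (1) the win bit is the sum of all terms
  have hwin : ∀ U, ind (ringWinU c y U) = ∑ p, term p U := by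
    intro U
    unfold ringWinU
    rw [ind_decide_mod_two, card_filter_cast]
    rw [Fintype.sum_prod_type]
    refine Finset.sum_congr rfl fun g _ => ?_
    simp only [hterm]
    have hsplit : (if (y g U = true ∧ (c + g.val + walkExp U g.val) % 3 ≠ 0) then (1 : ZMod 2) else 0) =
        ind (y g U) * ind (decide ((c + g.val + walkExp U g.val) % 3 ≠ 0)) := by
      unfold ind
      by_cases h1 : y g U = true <;> by_cases h2 : (c + g.val + walkExp U g.val) % 3 ≠ 0 <;>
        simp [h1, h2]
    rw [hsplit, ha g U, Finset.sum_mul]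
  -- (2) regroup by blocks
  have hreg : ∀ U, ∑ p, term p U = ∑ j ∈ range k, F j U := by
    intro U
    simp only [hF, hfib]
    exact (sum_fiberwise_of_maps_to (fun p _ => mem_range.2 (hasg p.1 p.2).1) _).symm
  -- (3) on block `j` the term is read off the triple at `r = |U_j| mod 3`
  have hFG : ∀ j U, F j U = G j (SumCodeZero.bw blk j U % 3) U := by
    intro j U
    simp only [hF, hG, hterm]
    refine Finset.sum_congr rfl fun p hp => ?_
    have hj : asg p.1 p.2 = j := (mem_filter.1 hp).2
    have hos : OneSided blk j p.1.val := hj ▸ (hasg p.1 p.2).2.1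
    rw [char_mod_eq hos]
  -- (4) the triples are even
  have hGeven : ∀ j U, G j 0 U + G j 1 U + G j 2 U = 0 := by
    intro j U
    simp only [hG]
    rw [← Finset.sum_add_distrib, ← Finset.sum_add_distrib]
    refine Finset.sum_eq_zero fun p _ => ?_
    have h := ind_add3_of_xor _ _ _ (chR_even (blk := blk) c p.1.val j U)
    linear_combination (a p.1 p.2 * mono (ZMod 2) p.2.1 U) * h
  -- (5) the triples have block-degree `≤ t`
  have hGdeg : ∀ j r (v : Fin N → Bool),
      (fun w => G j r (SumCodeZero.ovr blk j v w)) ∈ lowDeg (ZMod 2) N t := by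
    intro j r v
    have heq : (fun w => G j r (SumCodeZero.ovr blk j v w)) =
        ∑ p ∈ fib j, (a p.1 p.2 * mono (ZMod 2) (p.2.1.filter fun i => ¬ blk i = j) v *
            ind (decide (chR blk c p.1.val j r v % 3 ≠ 0))) •
          mono (ZMod 2) (p.2.1.filter fun i => blk i = j) := by
      funext w
      simp only [hG, Finset.sum_apply, Pi.smul_apply, smul_eq_mul]
      refine Finset.sum_congr rfl fun p _ => ?_
      rw [mono_ovr, chR_ovr]
      ring
    rw [heq]
    refine Submodule.sum_mem _ fun p hp => Submodule.smul_mem _ _ (mono_mem_lowDeg ?_)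
    have hj : asg p.1 p.2 = j := (mem_filter.1 hp).2
    exact hj ▸ (hasg p.1 p.2).2.2
  -- the patterns and triples
  refine ⟨fun j U => decide (F j U = 1), fun j _ => ⟨fun r U => decide (G j r U = 1),
    fun r v => ?_, fun U => xor3_of_sum_zero _ _ _ (hGeven j U), fun U => by beta_reduce; rw [hFG]⟩,
    fun U => ?_⟩
  · -- block degree
    unfold HasDeg
    have : (fun x => if decide (G j r (SumCodeZero.ovr blk j v x) = 1) = true then (1 : ZMod 2) else 0) =
        fun w => G j r (SumCodeZero.ovr blk j v w) := by
      funext w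
      exact ind_decide_eq_one _
    rw [this]
    exact hGdeg j r v
  · -- the win bit is the parity of the block patterns
    show ringWinU c y U = decide (((range k).filter fun j => decide (F j U = 1) = true).card % 2 = 1)
    have hsum : ind (ringWinU c y U) =
        ((((range k).filter fun j => decide (F j U = 1) = true).card : ℕ) : ZMod 2) := by
      rw [hwin, hreg, card_filter_cast]
      refine Finset.sum_congr rfl fun j _ => ?_
      have := ind_decide_eq_one (F j U)
      unfold ind at this
      rw [this]
    cases hW : ringWinU c y U
    · rw [hW] at hsum
      simp only [ind, Bool.false_eq_true, if_false] at hsum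
      have hev := (ZMod.natCast_eq_zero_iff_even.1 hsum.symm)
      rw [Nat.even_iff] at hev
      rw [hev]; simp
    · rw [hW] at hsum
      simp only [ind, if_true] at hsum
      have hodd := (ZMod.natCast_eq_one_iff_odd.1 hsum.symm)
      rw [Nat.odd_iff] at hodd
      rw [hodd]; simp

end BlockSplitCore

end Summit.QuantumAdvantage.AdviceFreeQNC0
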